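import Mathlib
import HarnessLib
import Summits.Ventures.LatticeQCDFlow.Exactness.SphereLatticeLaplacianSelfAdjoint
import Summits.Ventures.LatticeQCDFlow.Exactness.SphereLuscherSeriesUniqueness

/-!
# Lüscher's recursion on the lattice of spheres is solved at every order by one universal polynomial in `𝔏₀`: `S̃⁽ᵏ⁾ = q_{N}(𝔏₀) R⁽ᵏ⁾ + const`, `q_N` the Lagrange interpolant of `λ ↦ λ⁻¹` on the labels

HONEST FRAMING: exact (Metropolis-corrected) sampling algorithms for lattice gauge theory;
figures of merit are autocorrelation/cost numbers at stated couplings and volumes; no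
continuum-physics claim.

Venture `LatticeQCDFlow` (cell pub-lqcd), topic `Exactness`; FANOUT row 7 (`s0-cpn-null`: the
S0-D1 rung — 2D CP⁹, Lüscher's LO trivializing map inside HMC, Engel–Schaefer 2011).  NEW WORK of
the cell over the tree's `Exactness/SphereLatticeLaplacianSelfAdjoint.lean` (orthonormal
eigenbasis of `𝔏₀` on `polyS N|_Ω`, eigenvalues among the labels),
`Exactness/SphereLatticeLaplacianSpectrum.lean`, `Exactness/LatticeSitePolynomialOperator.lean`
(`polyLap`), `Exactness/SphereLuscherSeriesExistence.lean` (`latticeCarre`, the graded source) and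
`Exactness/SphereLuscherSeriesUniqueness.lean` (`luscher_series_unique`); Mathlib's
`Lagrange.interpolate`; nothing is cited as a fact.  Printed counterpart, NAMED ONLY: M. Lüscher,
Commun. Math. Phys. 293 (2010) 899, §3.3 eqs. (3.9)–(3.12) and §4.4 (each order "can be worked out
by linear algebra" in a finite-dimensional invariant space); Engel–Schaefer, Comput. Phys. Commun.
182 (2011) 2107, §3 eq. (15) (order `0` in closed form); for O(3), orders `0–2` by hand in
Chamness–Kovner–Orginos, PoS LATTICE2023 008.  What this file adds: NO LINEAR SOLVE AND NO HARMONIC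
PROJECTION IS NEEDED AT ANY ORDER — the inverse of `𝔏₀` on its invariant polynomial spaces is a
universal polynomial in `𝔏₀` itself, with coefficients depending only on the degree and on
`d = dim E`.

## Content (`E` finite-dimensional, `d = dim E ≥ 2`; `Λ` finite; `Ω = S(E)^Λ`)

* `labelSet N` — the finite set of labels `Σ_n c_n (c_n + d − 2)` of the site monomials of degree
  `≤ N` (`mem_labelSet`); **`solverPoly N`** — THE UNIVERSAL SOLVER POLYNOMIAL `q_N ∈ ℝ[X]`: the
  Lagrange interpolant of `λ ↦ λ⁻¹` (`0 ↦ 0`) on `labelSet N` (`eval_solverPoly`,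
  `mul_eval_solverPoly`: `λ·q_N(λ) = 1` for a nonzero label, `= 0` at `λ = 0`).
* `toV_aeval` (restriction commutes with polynomials in `𝔏`); **`LΩ_aeval_solverPoly`**: on
  `polyS N|_Ω`, `𝔏₀ (q_N(𝔏₀) v) = v − w` with `𝔏₀ w = 0` (expand in the eigenbasis);
  `exists_const_of_LΩ_eq_zero` (`ker 𝔏₀` = constants, `SphereLatticeLuscherKernel`).
* **`solverPoly_solves`** — THE POISSON PROBLEM IN CLOSED FORM: for every lattice polynomial `R` of
  degree `≤ N`, `X := q_N(𝔏) R ∈ polyS N` satisfies `−Σ_k ∂̃_k·∂̃_k X = R + c` on the product of unit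
  spheres, for a constant `c`.
* `solverRec`, **`solverTerm`** — LÜSCHER'S SERIES COMPUTED EXPLICITLY: `T⁽⁰⁾ = q_a(𝔏) S`,
  `T⁽ᵏ⁺¹⁾ = q_{a(k+2)}(𝔏) (−Σ_n ambCarre n S T⁽ᵏ⁾)` for an action `S ∈ polyS a`;
  `solverTerm_mem` (degree `≤ a(k+1)`), `solverTerm_zero_eq`, `solverTerm_succ_eq` (it IS a Lüscher
  series); **`luscher_series_eq_solverTerm`** — EVERY `C²` LÜSCHER SERIES OF A POLYNOMIAL ACTION
  AGREES WITH `(T⁽ᵏ⁾)` ORDER BY ORDER UP TO ADDITIVE CONSTANTS ON THE SPHERES, WITH THE SAME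
  CONSTANTS `ċ_k`; **`luscher_series_esAction_eq_solverTerm`** — in particular the CP(N−1)/O(N)
  flow-action series of Engel–Schaefer's action (degrees `2(k+1)`).

NOT CLAIMED: minimality of `deg q_N` (repeated / absent labels are not pruned); efficient evaluation;
any statement at flow time `t > 0`; numbers of the rung.
-/

noncomputable section

namespace Summit.Ventures.LatticeQCDFlow.Exactness

open Function Set Metric MeasureTheory Polynomial
open scoped RealInnerProductSpace

variable {Λ : Type*} {E : Type*} [NormedAddCommGroup E] [InnerProductSpace ℝ E]
variable [Fintype Λ] [DecidableEq Λ]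

/-! ## §1 The universal solver polynomial -/

section SolverPoly

variable (Λ E) in
/-- **The set of labels** of the site monomials of degree `≤ N` (a finite set of reals depending on
`N`, `d` and — through the available multidegrees — on `|Λ|` only by truncation). -/
def labelSet (N : ℕ) : Finset ℝ :=
  (Finset.range (N + 1)).biUnion fun k =>
    Finset.univ.image fun κs : Fin k → SiteCoord Λ E => eigLabel κs

/-- Membership in `labelSet N`. -/
theorem mem_labelSet {N : ℕ} {μ : ℝ} :
    μ ∈ labelSet Λ E N ↔ ∃ k ≤ N, ∃ κs : Fin k → SiteCoord Λ E, μ = eigLabel κs := by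
  simp only [labelSet, Finset.mem_biUnion, Finset.mem_range, Finset.mem_image, Finset.mem_univ,
    true_and]
  constructor
  · rintro ⟨k, hk, κs, h⟩
    exact ⟨k, by omega, κs, h.symm⟩
  · rintro ⟨k, hk, κs, h⟩
    exact ⟨k, by omega, κs, h.symm⟩

/-- `0 ∈ labelSet N` (the constant monomial). -/
theorem zero_mem_labelSet (N : ℕ) : (0 : ℝ) ∈ labelSet Λ E N :=
  mem_labelSet.2 ⟨0, Nat.zero_le N, Fin.elim0, (eigLabel_fin_zero _).symm⟩

variable (Λ E) in
/-- **THE UNIVERSAL SOLVER POLYNOMIAL `q_N`**: the Lagrange interpolant of `λ ↦ λ⁻¹` on the labels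
of degree `≤ N` (with `0⁻¹ = 0`: `q_N(0) = 0`). Its coefficients depend on `N`, `d` (and the
truncation by `|Λ|` of the available multidegrees) only. -/
def solverPoly (N : ℕ) : ℝ[X] := Lagrange.interpolate (labelSet Λ E N) id fun μ => μ⁻¹

/-- **`q_N(λ) = λ⁻¹` on every label.** -/
theorem eval_solverPoly {N : ℕ} {μ : ℝ} (hμ : μ ∈ labelSet Λ E N) :
    (solverPoly Λ E N).eval μ = μ⁻¹ := by
  have h := Lagrange.eval_interpolate_at_node (fun μ : ℝ => μ⁻¹)
    (Set.injOn_id (labelSet Λ E N : Set ℝ)) hμ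
  simpa [solverPoly] using h

/-- **`λ · q_N(λ) = 1` for a nonzero label, `= 0` for the label `0`.** -/
theorem mul_eval_solverPoly {N : ℕ} {μ : ℝ} (hμ : μ ∈ labelSet Λ E N) :
    μ * (solverPoly Λ E N).eval μ = if μ = 0 then 0 else 1 := by
  rw [eval_solverPoly hμ]
  split_ifs with h
  · rw [h, zero_mul]
  · exact mul_inv_cancel₀ h

end SolverPoly

/-! ## §2 `𝔏₀ q_N(𝔏₀) = 1 − Π₀` on `polyS N|_Ω` -/

section OnV

variable [FiniteDimensional ℝ E]

omit [Fintype Λ] [DecidableEq Λ] in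
/-- Pointwise subtraction in `VΩ N`. -/
@[simp] theorem VΩ.sub_apply {N : ℕ} (u v : VΩ Λ E N) (ω : Λ → sphere (0 : E) 1) :
    (u - v) ω = u ω - v ω := rfl

/-- **Restriction commutes with polynomials in `𝔏`**: `(p(𝔏) f)|_Ω = p(𝔏₀) (f|_Ω)`. -/
theorem toV_aeval {N : ℕ} (p : ℝ[X]) (f : polyS Λ E N) :
    toV Λ E N (aeval (polyLap Λ E N) p f) = aeval (LΩ Λ E N) p (toV Λ E N f) := by
  induction p using Polynomial.induction_on with
  | C a =>
      rw [aeval_C, aeval_C, Module.algebraMap_end_apply, Module.algebraMap_end_apply, map_smul]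
  | add p q hp hq => rw [map_add, map_add, LinearMap.add_apply, LinearMap.add_apply, map_add, hp, hq]
  | monomial n a h =>
      have e : C a * X ^ (n + 1) = X * (C a * X ^ n) := by ring
      rw [e]
      conv_lhs => rw [map_mul, Module.End.mul_apply, aeval_X]
      conv_rhs => rw [map_mul, Module.End.mul_apply, aeval_X]
      rw [← LΩ_toV, h]

variable [MeasurableSpace E] [BorelSpace E]

/-- **`𝔏₀ (q_N(𝔏₀) v) = v − w` with `𝔏₀ w = 0`**, for every `v ∈ polyS N|_Ω` (expand `v` in the
orthonormal eigenbasis of `SphereLatticeLaplacianSelfAdjoint`; on an eigenvector of label `λ`,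
`𝔏₀ q_N(𝔏₀)` acts as `λ q_N(λ) ∈ {0, 1}`). -/
theorem LΩ_aeval_solverPoly [Nontrivial E] {N : ℕ} (v : VΩ Λ E N) :
    ∃ w : VΩ Λ E N, LΩ Λ E N w = 0 ∧
      LΩ Λ E N (aeval (LΩ Λ E N) (solverPoly Λ E N) v) = v - w := by
  obtain ⟨b, μ, hb, hμ⟩ := exists_orthonormal_eigenbasis_LΩ (Λ := Λ) (E := E) N
  set L := LΩ Λ E N
  have hmem : ∀ i, μ i ∈ labelSet Λ E N := fun i => mem_labelSet.2 (hμ i)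
  -- coordinates of `v`
  set c : Fin (Module.finrank ℝ (VΩ Λ E N)) → ℝ := fun i => b.repr v i
  have hv : v = ∑ i, c i • b i := (b.sum_repr v).symm
  refine ⟨∑ i, (if μ i = 0 then c i else 0) • b i, ?_, ?_⟩
  · rw [map_sum]
    refine Finset.sum_eq_zero fun i _ => ?_
    rw [map_smul, hb i, smul_smul]
    split_ifs with h
    · rw [h, mul_zero, zero_smul]
    · rw [zero_mul, zero_smul]
  · have h1 : aeval L (solverPoly Λ E N) v =
        ∑ i, (c i * (solverPoly Λ E N).eval (μ i)) • b i := by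
      conv_lhs => rw [hv]
      rw [map_sum]
      refine Finset.sum_congr rfl fun i _ => ?_
      rw [map_smul, Module.End.aeval_apply_of_mem_apply_eq_smul (hb i), smul_smul]
    rw [h1, map_sum]
    have h2 : ∀ i, L ((c i * (solverPoly Λ E N).eval (μ i)) • b i) =
        (c i * (if μ i = 0 then 0 else 1)) • b i := by
      intro i
      rw [map_smul, hb i, smul_smul, ← mul_eval_solverPoly (hmem i)]
      congr 1
      ring
    simp_rw [h2]
    conv_rhs => rw [hv]
    rw [← Finset.sum_sub_distrib]
    refine Finset.sum_congr rfl fun i _ => ?_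
    rw [← sub_smul]
    congr 1
    split_ifs <;> ring

/-- **The kernel of `𝔏₀` on `polyS N|_Ω` is the constants** (`dim E ≥ 2`;
`SphereLatticeLuscherKernel.eq_of_sum_siteLaplacian_eq_zero`). -/
theorem exists_const_of_LΩ_eq_zero (h2 : 2 ≤ Module.finrank ℝ E) {N : ℕ} {w : VΩ Λ E N}
    (hw : LΩ Λ E N w = 0) : ∃ c₀ : ℝ, ∀ ω : Λ → sphere (0 : E) 1, w ω = c₀ := by
  obtain ⟨g, rfl⟩ := toV_surjective N w
  rcases isEmpty_or_nonempty (Λ → sphere (0 : E) 1) with hΩ | ⟨⟨ω₀⟩⟩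
  · exact ⟨0, fun ω => (hΩ.false ω).elim⟩
  refine ⟨toV Λ E N g ω₀, fun ω => ?_⟩
  have h0 : ∀ ω : Λ → sphere (0 : E) 1,
      ∑ k, siteLaplacian k (g : (Λ → E) → ℝ) (fun n => (ω n : E)) = 0 := fun ω => by
    have h := congrFun (congrArg (fun u : VΩ Λ E N => (u : (Λ → sphere (0 : E) 1) → ℝ)) hw) ω
    simp only [LΩ_toV_apply, VΩ.zero_apply, neg_eq_zero] at h
    exact h
  rw [toV_apply, toV_apply]
  exact eq_of_sum_siteLaplacian_eq_zero h2 (polyS_contDiff_two N _ g.2) h0 ω ω₀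

/-- **THE POISSON PROBLEM IN CLOSED FORM.**  For every lattice polynomial `R` of degree `≤ N`, the
lattice polynomial `X := q_N(𝔏) R` (of degree `≤ N`) solves Lüscher's equation
`−Σ_k ∂̃_k·∂̃_k X = R + c` on the product of unit spheres, for some constant `c` (`dim E ≥ 2`). -/
theorem solverPoly_solves (h2 : 2 ≤ Module.finrank ℝ E) {N : ℕ} (R : polyS Λ E N) :
    ∃ c : ℝ, ∀ ξ : Λ → sphere (0 : E) 1,
      -∑ k, siteLaplacian k (aeval (polyLap Λ E N) (solverPoly Λ E N) R : (Λ → E) → ℝ)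
          (fun n => (ξ n : E)) = (R : (Λ → E) → ℝ) (fun n => (ξ n : E)) + c := by
  haveI : Nontrivial E := Module.nontrivial_of_finrank_pos (R := ℝ) (by omega)
  obtain ⟨w, hw0, hw⟩ := LΩ_aeval_solverPoly (Λ := Λ) (E := E) (toV Λ E N R)
  obtain ⟨c₀, hc₀⟩ := exists_const_of_LΩ_eq_zero h2 hw0
  refine ⟨-c₀, fun ξ => ?_⟩
  have h := congrFun (congrArg (fun u : VΩ Λ E N => (u : (Λ → sphere (0 : E) 1) → ℝ)) hw) ξ
  rw [← toV_aeval, LΩ_toV_apply] at h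
  rw [h, VΩ.sub_apply, toV_apply, hc₀ ξ]
  ring

end OnV

/-! ## §3 Lüscher's series computed by the universal polynomials -/

section Series

variable [FiniteDimensional ℝ E] [MeasurableSpace E] [BorelSpace E]

/-- **Lüscher's recursion, solved explicitly**: order `0` is `q_a(𝔏) S`, order `k+1` is
`q(𝔏)` of the source `−latticeCarre S T⁽ᵏ⁾`; the degree is carried along. -/
def solverRec {a : ℕ} {S : (Λ → E) → ℝ} (hS : S ∈ polyS Λ E a) : ℕ → Σ N : ℕ, polyS Λ E N
  | 0 => ⟨a, aeval (polyLap Λ E a) (solverPoly Λ E a) ⟨S, hS⟩⟩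
  | k + 1 => ⟨a + (solverRec hS k).1,
      aeval (polyLap Λ E (a + (solverRec hS k).1)) (solverPoly Λ E (a + (solverRec hS k).1))
        ⟨fun x => -latticeCarre S ((solverRec hS k).2 : (Λ → E) → ℝ) x,
          neg_latticeCarre_mem_polyS hS (solverRec hS k).2.2⟩⟩

/-- **The explicit order-`k` flow action `T⁽ᵏ⁾`.** -/
def solverTerm {a : ℕ} {S : (Λ → E) → ℝ} (hS : S ∈ polyS Λ E a) (k : ℕ) : (Λ → E) → ℝ :=
  ((solverRec hS k).2 : (Λ → E) → ℝ)

omit [MeasurableSpace E] [BorelSpace E] in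
/-- The degree carried at order `k` is `a(k+1)`. -/
theorem solverRec_fst {a : ℕ} {S : (Λ → E) → ℝ} (hS : S ∈ polyS Λ E a) :
    ∀ k, (solverRec hS k).1 = a * (k + 1)
  | 0 => by simp [solverRec]
  | k + 1 => by
      show a + (solverRec hS k).1 = a * (k + 1 + 1)
      rw [solverRec_fst hS k]; ring

omit [MeasurableSpace E] [BorelSpace E] in
/-- **`T⁽ᵏ⁾` is a lattice polynomial of degree `≤ a(k+1)`.** -/
theorem solverTerm_mem {a : ℕ} {S : (Λ → E) → ℝ} (hS : S ∈ polyS Λ E a) (k : ℕ) :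
    solverTerm hS k ∈ polyS Λ E (a * (k + 1)) :=
  polyS_mono (le_of_eq (solverRec_fst hS k)) (solverRec hS k).2.2

/-- **Order `0`**: `−Σ∂̃² T⁽⁰⁾ = S + ċ₀` on the spheres. -/
theorem solverTerm_zero_eq (h2 : 2 ≤ Module.finrank ℝ E) {a : ℕ} {S : (Λ → E) → ℝ}
    (hS : S ∈ polyS Λ E a) : ∃ c : ℝ, ∀ ξ : Λ → sphere (0 : E) 1,
      -∑ n, siteLaplacian n (solverTerm hS 0) (fun m => (ξ m : E)) = S (fun m => (ξ m : E)) + c :=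
  solverPoly_solves h2 ⟨S, hS⟩

/-- **Order `k+1`**: `−Σ∂̃² T⁽ᵏ⁺¹⁾ = −Σ_n ⟪∂̃_n S, ∂̃_n T⁽ᵏ⁾⟫ + ċ_{k+1}` on the spheres. -/
theorem solverTerm_succ_eq (h2 : 2 ≤ Module.finrank ℝ E) {a : ℕ} {S : (Λ → E) → ℝ}
    (hS : S ∈ polyS Λ E a) (k : ℕ) : ∃ c : ℝ, ∀ ξ : Λ → sphere (0 : E) 1,
      -∑ n, siteLaplacian n (solverTerm hS (k + 1)) (fun m => (ξ m : E)) =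
        -(∑ n, ⟪siteGrad n S (fun m => (ξ m : E)),
            siteGrad n (solverTerm hS k) (fun m => (ξ m : E))⟫) + c := by
  obtain ⟨c, hc⟩ := solverPoly_solves h2
    (⟨fun x => -latticeCarre S ((solverRec hS k).2 : (Λ → E) → ℝ) x,
      neg_latticeCarre_mem_polyS hS (solverRec hS k).2.2⟩ :
      polyS Λ E (a + (solverRec hS k).1))
  refine ⟨c, fun ξ => ?_⟩
  have hX := contDiff_of_mem_polyS (solverTerm_mem hS k)
  rw [sum_inner_siteGrad_eq_latticeCarre (contDiff_of_mem_polyS hS) hX fun n => by simp]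
  exact hc ξ

/-- **EVERY `C²` LÜSCHER SERIES OF A POLYNOMIAL ACTION IS THE EXPLICIT ONE, UP TO CONSTANTS.**  On
`S(E)^Λ` (`dim E ≥ 2`, `Λ` nonempty), if `(St, c)` solves Lüscher's recursion for an action
`S ∈ polyS a` with every `St k ∈ C²`, then for every `k` the constant `c k` equals that of the
explicit series and `St k = T⁽ᵏ⁾ + d_k` on the product of unit spheres — where
`T⁽ᵏ⁾ = solverTerm hS k` is obtained from `S` by alternating the carré du champ with the universal
polynomials `q_{a(j+1)}(𝔏)`. -/
theorem luscher_series_eq_solverTerm [Nonempty Λ] (h2 : 2 ≤ Module.finrank ℝ E) {a : ℕ}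
    {S : (Λ → E) → ℝ} (hS : S ∈ polyS Λ E a) {St : ℕ → (Λ → E) → ℝ} {c : ℕ → ℝ}
    (hSt : ∀ k, ContDiff ℝ 2 (St k))
    (h0 : ∀ ξ : Λ → sphere (0 : E) 1,
      -∑ n, siteLaplacian n (St 0) (fun m => (ξ m : E)) = S (fun m => (ξ m : E)) + c 0)
    (hs : ∀ k, ∀ ξ : Λ → sphere (0 : E) 1,
      -∑ n, siteLaplacian n (St (k + 1)) (fun m => (ξ m : E)) =
        -(∑ n, ⟪siteGrad n S (fun m => (ξ m : E)), siteGrad n (St k) (fun m => (ξ m : E))⟫) +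
          c (k + 1)) (k : ℕ) :
    ∃ d : ℝ, ∀ ξ : Λ → sphere (0 : E) 1,
      St k (fun m => (ξ m : E)) = solverTerm hS k (fun m => (ξ m : E)) + d := by
  have hT : ∀ k, ContDiff ℝ 2 (solverTerm hS k) := fun k =>
    contDiff_infty.1 (contDiff_of_mem_polyS (solverTerm_mem hS k)) 2
  have key := luscher_series_unique h2 hSt hT h0
    (c' := fun j => Nat.casesOn j (Classical.choose (solverTerm_zero_eq h2 hS))
      fun i => Classical.choose (solverTerm_succ_eq h2 hS i))
    (Classical.choose_spec (solverTerm_zero_eq h2 hS)) hs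
    (fun j => Classical.choose_spec (solverTerm_succ_eq h2 hS j)) k
  exact key.2

/-- **THE CP(N−1)/O(N) FLOW-ACTION SERIES IN CLOSED FORM AT EVERY ORDER.**  For the Engel–Schaefer
action (ANY couplings `U`), every `C²` Lüscher series agrees on the spheres, order by order and up
to additive constants, with the explicit `T⁽ᵏ⁾` of degree `≤ 2(k+1)` computed from `S` by carré du
champ and the universal polynomials `q_{2(j+1)}(𝔏)`. -/
theorem luscher_series_esAction_eq_solverTerm [Nonempty Λ] (h2 : 2 ≤ Module.finrank ℝ E)
    (κ S₀ : ℝ) (U : Λ → Λ → (E →L[ℝ] E)) {St : ℕ → (Λ → E) → ℝ} {c : ℕ → ℝ}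
    (hSt : ∀ k, ContDiff ℝ 2 (St k))
    (h0 : ∀ ξ : Λ → sphere (0 : E) 1,
      -∑ n, siteLaplacian n (St 0) (fun m => (ξ m : E)) =
        esAction κ S₀ U (fun m => (ξ m : E)) + c 0)
    (hs : ∀ k, ∀ ξ : Λ → sphere (0 : E) 1,
      -∑ n, siteLaplacian n (St (k + 1)) (fun m => (ξ m : E)) =
        -(∑ n, ⟪siteGrad n (esAction κ S₀ U) (fun m => (ξ m : E)),
            siteGrad n (St k) (fun m => (ξ m : E))⟫) + c (k + 1)) (k : ℕ) :
    solverTerm (esAction_mem_polyS κ S₀ U) k ∈ polyS Λ E (2 * (k + 1)) ∧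
      ∃ d : ℝ, ∀ ξ : Λ → sphere (0 : E) 1,
        St k (fun m => (ξ m : E)) = solverTerm (esAction_mem_polyS κ S₀ U) k (fun m => (ξ m : E)) + d :=
  ⟨solverTerm_mem _ k, luscher_series_eq_solverTerm h2 (esAction_mem_polyS κ S₀ U) hSt h0 hs k⟩

end Series

end Summit.Ventures.LatticeQCDFlow.Exactness

end
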